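import Summits.BirchSwinnertonDyer.BirchSwinnertonDyer.Theorems.ResidualThetaTransportAtTwoThetaLayerLambdaCongruenceAtTwoManinSymbolTorsion
import Summits.BirchSwinnertonDyer.BirchSwinnertonDyer.Theorems.ResidualThetaTransportAtTwoThetaLayerLambdaCongruenceAtTwoManinChain
import Summits.BirchSwinnertonDyer.BirchSwinnertonDyer.Theorems.ResidualThetaTransportAtTwoThetaLayerLambdaCongruenceAtTwoManinTrick
import Literature.NumberTheory.EllipticCurves.ModularSymbolsManinExact
import HarnessLib

/-!
# Crux `ThetaLayerLambdaCongruenceAtTwo` (stmt-BirchSwinnertonDyer-20688, route ResidualThetaTransportAtTwo), line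
# `birth`, stub (C3k) — ITEM B1 ASSEMBLED: the period homomorphism of a `T₂`-killed symbol function FACTORS THROUGH
# THE PERIOD LATTICE `H₁(X₀(N), ℤ) ⊂ S₂(Γ₀(N))^∨` (lead prover bsd-wall-rtt-p3 g3;
# `--supports stmt-BirchSwinnertonDyer-20688 --as helper`; closes nothing)

HONEST FRAMING. THEOREMS about functions `Φ : ℚ → R`; the only external input is the genus-cum-dimension formula
`twelve_mul_finrank_cuspForm_two (Gamma0 N)` (a Literature named fact, hypothesis). Nothing about any curve is
asserted; BSD is not proved by any of this.

WHAT (`periods_eq_zero_of_periodFunctionals_eq_zero`). Let `N` be odd, `R` an additive group with `3r = 0 ⇒ r = 0`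
(e.g. an `𝔽₂`-vector space), `Φ : ℚ → R` a Γ₀(N)-symbol function (Manin's relation) with `T₂Φ = 0` pointwise. If an
integral combination of period functionals vanishes in `S₂(Γ₀(N))^∨`, `Σᵢ nᵢ·{∞, γᵢ∞} = 0` (`γᵢ ∈ Γ₀(N)`), then the same
combination of the periods of `Φ` vanishes: `Σᵢ nᵢ·Φ(γᵢ·∞) = 0`. Equivalently: `γ ↦ Φ(γ·∞)` factors through
`γ ↦ periodFunctional N γ ∈ Λ = periodHomology N ≅ H₁(X₀(N), ℤ)`, i.e. defines an additive map `Λ → R`.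
PROOF = the B1 chain of `Lines/birth-C3k-plan.md`: universal Manin chains (`…ManinChain`) turn the hypothesis into a
rational cycle `c ∈ ℤ^X` (`X = SL₂(ℤ)/Γ₀(N)`) with `Ψ(c) = 0`, `δ(c) = 0`; Manin's presentation is exact over `ℚ`
(`Literature…ModularSymbolsManinExact`, from the genus formula), so `c ∈ Rel_ℚ`; clearing denominators,
`D·c = A + B` with `A` `S`-invariant and `B` `TS`-invariant INTEGRAL; the Manin-symbol system of `Φ` on `X` satisfies the
two- and three-term relations (`…ManinSymbols`) and vanishes on `S`-fixed cosets (`…EllipticExclusion` via `T₂Φ = 0`) and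
on `TS`-fixed cosets (`3[h] = 0`); the torsion lemma (`…ManinSymbolTorsion`) gives `⟨c, M_Φ⟩ = 0`, and `⟨c, M_Φ⟩ =
Σ nᵢ Φ̂(γᵢ)` by the abstract reading of the chains.

References: [Manin1972] Thm. 1.6, Thm. 1.9; [CremonaAlgorithms1997] §2.1–2.3; [Merel1994] §1.2; Wiese, Computational
arithmetic of modular forms, Prop. 5.1, Thm. 5.7, Thm. 5.9.
-/

noncomputable section

-- justification: the `Summit.BirchSwinnertonDyer.BirchSwinnertonDyer.…` path repeats a component (route-file convention)
set_option linter.dupNamespace false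

open scoped Classical MatrixGroups

open CongruenceSubgroup Matrix.SpecialLinearGroup ModularGroup
open Literature.NumberTheory.EllipticCurves.ModularForms

namespace Summit.BirchSwinnertonDyer.BirchSwinnertonDyer.Theorems.ThetaLayerLambdaCongruenceAtTwo

/-! ## §1. Small matrix facts and the Manin-symbol system on the coset space -/

section CosetSymbols

variable {R : Type} [AddCommGroup R] {N : ℕ} {Φ : ℚ → R}

/-- `S⁻¹ = -S` in `SL₂(ℤ)`. [folklore] -/
theorem S_inv_eq_neg_S : (S : SL(2, ℤ))⁻¹ = -S := by
  rw [inv_eq_iff_mul_eq_one, mul_neg, S_mul_S_eq_neg_one, neg_neg]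

/-- `(TS)⁻¹ = -(S T⁻¹)` and `S T⁻¹ = (0,-1;1,-1)`. [folklore] -/
theorem TS_inv_eq : (T * S : SL(2, ℤ))⁻¹ = -(S * T⁻¹) := by
  rw [mul_inv_rev, S_inv_eq_neg_S, neg_mul]

/-- The cusp value `Φ̂(-g) = Φ̂(g)`. [folklore] -/
theorem maninCusp_neg_sl (Φ : ℚ → R) (g : SL(2, ℤ)) :
    (if ((-g) 1 0) = 0 then (0 : R) else Φ ((((-g) 0 0 : ℚ)) / (((-g) 1 0 : ℚ)))) =
      (if (g 1 0) = 0 then 0 else Φ (((g 0 0 : ℚ)) / ((g 1 0 : ℚ)))) := by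
  have e0 : (-g) 0 0 = -g 0 0 := by simp
  have e1 : (-g) 1 0 = -g 1 0 := by simp
  simp only [e0, e1, neg_eq_zero, Int.cast_neg, neg_div_neg_eq]

/-- The Manin symbol `[-g]_Φ = [g]_Φ`. [folklore] -/
theorem maninSymbol_neg (Φ : ℚ → R) (g : SL(2, ℤ)) :
    ((if ((-g) 1 0) = 0 then (0 : R) else Φ ((((-g) 0 0 : ℚ)) / (((-g) 1 0 : ℚ)))) -
      (if ((-g * S) 1 0) = 0 then 0 else Φ ((((-g * S) 0 0 : ℚ)) / (((-g * S) 1 0 : ℚ))))) =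
      ((if (g 1 0) = 0 then 0 else Φ (((g 0 0 : ℚ)) / ((g 1 0 : ℚ)))) -
      (if ((g * S) 1 0) = 0 then 0 else Φ ((((g * S) 0 0 : ℚ)) / (((g * S) 1 0 : ℚ))))) := by
  rw [neg_mul, maninCusp_neg_sl, maninCusp_neg_sl]

end CosetSymbols

/-! ## §2. A left-`Γ₀(N)`-invariant function on `SL₂(ℤ)` read on the coset space `X = SL₂(ℤ)/Γ₀(N)` (tree convention
`gΓ₀(N) ↦ value at g⁻¹`) -/

section CosetSystem

variable {R : Type} [AddCommGroup R] {N : ℕ}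

omit [AddCommGroup R] in
/-- Reading a left-`Γ₀(N)`-invariant `MS : SL₂(ℤ) → R` on cosets through `Quotient.out`: the value at `gΓ₀(N)` is
`MS(g⁻¹)`. [folklore] -/
theorem apply_out_inv_mk (MS : SL(2, ℤ) → R) (hinv : ∀ (γ : Gamma0 N) (h : SL(2, ℤ)), MS ((γ : SL(2, ℤ)) * h) = MS h)
    (g : SL(2, ℤ)) : MS ((QuotientGroup.mk g : Gamma0Coset N).out)⁻¹ = MS g⁻¹ := by
  obtain ⟨γ, hγ⟩ := QuotientGroup.mk_out_eq_mul (Gamma0 N) g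
  rw [hγ, mul_inv_rev]
  have := hinv γ⁻¹ g⁻¹
  rwa [Subgroup.coe_inv] at this

/-- (i) on cosets: `M(S·q) = −M(q)` from `MS(hS) = −MS(h)` and `MS(−h) = MS(h)`. [folklore] -/
theorem cosetSystem_S (MS : SL(2, ℤ) → R) (hinv : ∀ (γ : Gamma0 N) (h : SL(2, ℤ)), MS ((γ : SL(2, ℤ)) * h) = MS h)
    (hneg : ∀ h, MS (-h) = MS h) (hS : ∀ h, MS (h * S) = -MS h) (q : Gamma0Coset N) :
    MS ((S • q).out)⁻¹ = -MS (q.out)⁻¹ := by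
  obtain ⟨g, rfl⟩ := QuotientGroup.mk_surjective q
  rw [MulAction.Quotient.smul_mk, apply_out_inv_mk MS hinv, apply_out_inv_mk MS hinv, smul_eq_mul,
    mul_inv_rev, S_inv_eq_neg_S, mul_neg, hneg, hS]

/-- (ii) on cosets: the three-term relation along `TS`, from `MS(h) + MS(hτ) + MS(hτ²) = 0`, `τ = S T⁻¹`. [folklore] -/
theorem cosetSystem_TS (MS : SL(2, ℤ) → R) (hinv : ∀ (γ : Gamma0 N) (h : SL(2, ℤ)), MS ((γ : SL(2, ℤ)) * h) = MS h)
    (hneg : ∀ h, MS (-h) = MS h) (h3t : ∀ h, MS h + MS (h * (S * T⁻¹)) + MS (h * (S * T⁻¹) * (S * T⁻¹)) = 0)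
    (q : Gamma0Coset N) :
    MS (q.out)⁻¹ + MS (((T * S) • q).out)⁻¹ + MS (((T * S) • (T * S) • q).out)⁻¹ = 0 := by
  obtain ⟨g, rfl⟩ := QuotientGroup.mk_surjective q
  have e1 : ∀ g : SL(2, ℤ), (T * S * g)⁻¹ = -(g⁻¹ * (S * T⁻¹)) := fun g ↦ by
    rw [mul_inv_rev, TS_inv_eq, mul_neg]
  have e2 : ∀ g : SL(2, ℤ), (T * S * (T * S * g))⁻¹ = g⁻¹ * (S * T⁻¹) * (S * T⁻¹) := fun g ↦ by
    rw [mul_inv_rev, e1, TS_inv_eq, neg_mul_neg, mul_assoc]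
  rw [MulAction.Quotient.smul_mk, MulAction.Quotient.smul_mk, apply_out_inv_mk MS hinv,
    apply_out_inv_mk MS hinv, apply_out_inv_mk MS hinv, smul_eq_mul, smul_eq_mul, e2, e1, hneg]
  exact h3t g⁻¹

/-- (iii) on cosets: `M` vanishes on `S`-fixed cosets if `MS(h) = 0` whenever `γh = hS` for some `γ ∈ Γ₀(N)`.
[folklore] -/
theorem cosetSystem_S_fixed (MS : SL(2, ℤ) → R) (hinv : ∀ (γ : Gamma0 N) (h : SL(2, ℤ)), MS ((γ : SL(2, ℤ)) * h) = MS h)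
    (hσ : ∀ (γ : Gamma0 N) (h : SL(2, ℤ)), (γ : SL(2, ℤ)) * h = h * S → MS h = 0) (q : Gamma0Coset N)
    (hq : S • q = q) : MS (q.out)⁻¹ = 0 := by
  obtain ⟨g, rfl⟩ := QuotientGroup.mk_surjective q
  rw [apply_out_inv_mk MS hinv]
  rw [MulAction.Quotient.smul_mk, QuotientGroup.eq, smul_eq_mul] at hq
  -- `γ₀ = (Sg)⁻¹ g ∈ Γ₀(N)`; `(-γ₀) g⁻¹ = g⁻¹ S`
  have hmem : -((S * g)⁻¹ * g) ∈ Gamma0 N := by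
    rw [neg_eq_neg_one_mul]; exact (Gamma0 N).mul_mem (by simp [Gamma0_mem] : (-1 : SL(2, ℤ)) ∈ Gamma0 N) hq
  refine hσ ⟨-((S * g)⁻¹ * g), hmem⟩ g⁻¹ ?_
  show -((S * g)⁻¹ * g) * g⁻¹ = g⁻¹ * S
  rw [neg_mul, mul_inv_cancel_right, mul_inv_rev, S_inv_eq_neg_S, mul_neg, neg_neg]

/-- (iv) on cosets: `M` vanishes on `TS`-fixed cosets if `MS(h) = 0` whenever `γh = hτ` (`τ = S T⁻¹`). [folklore] -/
theorem cosetSystem_TS_fixed (MS : SL(2, ℤ) → R)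
    (hinv : ∀ (γ : Gamma0 N) (h : SL(2, ℤ)), MS ((γ : SL(2, ℤ)) * h) = MS h)
    (hτ : ∀ (γ : Gamma0 N) (h : SL(2, ℤ)), (γ : SL(2, ℤ)) * h = h * (S * T⁻¹) → MS h = 0) (q : Gamma0Coset N)
    (hq : (T * S) • q = q) : MS (q.out)⁻¹ = 0 := by
  obtain ⟨g, rfl⟩ := QuotientGroup.mk_surjective q
  rw [apply_out_inv_mk MS hinv]
  rw [MulAction.Quotient.smul_mk, QuotientGroup.eq, smul_eq_mul] at hq
  have hmem : -((T * S * g)⁻¹ * g) ∈ Gamma0 N := by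
    rw [neg_eq_neg_one_mul]; exact (Gamma0 N).mul_mem (by simp [Gamma0_mem] : (-1 : SL(2, ℤ)) ∈ Gamma0 N) hq
  refine hτ ⟨-((T * S * g)⁻¹ * g), hmem⟩ g⁻¹ ?_
  show -((T * S * g)⁻¹ * g) * g⁻¹ = g⁻¹ * (S * T⁻¹)
  rw [neg_mul, mul_inv_cancel_right, mul_inv_rev, TS_inv_eq, mul_neg, neg_neg]

/-- The `τ`-fixed vanishing for a left-invariant system with the three-term relation in a group without `3`-torsion:
`γh = hτ` ⇒ `MS(hτ) = MS(hτ²) = MS(h)` ⇒ `3·MS(h) = 0`. [folklore] -/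
theorem apply_eq_zero_of_tau_fixed (MS : SL(2, ℤ) → R)
    (hinv : ∀ (γ : Gamma0 N) (h : SL(2, ℤ)), MS ((γ : SL(2, ℤ)) * h) = MS h)
    (h3t : ∀ h, MS h + MS (h * (S * T⁻¹)) + MS (h * (S * T⁻¹) * (S * T⁻¹)) = 0)
    (h3 : ∀ r : R, r + r + r = 0 → r = 0) (γ : Gamma0 N) (h : SL(2, ℤ))
    (hfix : (γ : SL(2, ℤ)) * h = h * (S * T⁻¹)) : MS h = 0 := by
  apply h3
  have e1 : MS (h * (S * T⁻¹)) = MS h := by rw [← hfix, hinv]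
  have e2 : MS (h * (S * T⁻¹) * (S * T⁻¹)) = MS h := by
    rw [← hfix, mul_assoc, ← hfix, hinv, hinv]
  have := h3t h
  rwa [e1, e2] at this

/-- Pairing an integral chain `Σ_{g ∈ L} e_{g⁻¹Γ₀(N)}` against a function on cosets. [folklore] -/
theorem sum_chainVec_smul [NeZero N] {V : Type*} [AddCommGroup V] (v : Gamma0Coset N → V) (L : List SL(2, ℤ)) :
    ∑ q, ((L.map fun g ↦ (Pi.single ((g⁻¹ : SL(2, ℤ)) : Gamma0Coset N) (1 : ℤ) : Gamma0Coset N → ℤ)).sum q) • v q =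
      (L.map fun g ↦ v ((g⁻¹ : SL(2, ℤ)) : Gamma0Coset N)).sum := by
  induction L with
  | nil => simp
  | cons g L ih =>
    simp only [List.map_cons, List.sum_cons, Pi.add_apply, add_smul, Finset.sum_add_distrib, ih]
    congr 1
    rw [Finset.sum_eq_single ((g⁻¹ : SL(2, ℤ)) : Gamma0Coset N)]
    · rw [Pi.single_eq_same, one_smul]
    · intro q _ hq; rw [Pi.single_eq_of_ne hq, zero_smul]
    · intro h; exact absurd (Finset.mem_univ _) h

/-- A rational with denominator dividing `D` becomes an integer after multiplication by `D`. [folklore] -/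
theorem exists_int_cast_eq_natCast_mul (x : ℚ) (D : ℕ) (h : x.den ∣ D) : ∃ z : ℤ, (z : ℚ) = (D : ℚ) * x := by
  obtain ⟨e, he⟩ := h
  refine ⟨(e : ℤ) * x.num, ?_⟩
  rw [he]
  push_cast
  calc (e : ℚ) * x.num = e * (x * x.den) := by rw [Rat.mul_den_eq_num]
    _ = (x.den : ℚ) * e * x := by ring

end CosetSystem

/-! ## §3. The assembly: periods of a `T₂`-killed symbol function factor through the period lattice -/

section Assembly

variable {R : Type} [AddCommGroup R] {N : ℕ} [NeZero N] {Φ : ℚ → R}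

/-- **B1 — the period homomorphism factors through `H₁(X₀(N), ℤ) ⊂ S₂(Γ₀(N))^∨`.** `N` odd, `R` without
`3`-torsion, `Φ : ℚ → R` a Γ₀(N)-symbol function with `T₂Φ = 0` pointwise; granted the genus formula
`twelve_mul_finrank_cuspForm_two (Gamma0 N)`: every integral linear relation `Σᵢ nᵢ·{∞, γᵢ∞} = 0` among period
functionals (`γᵢ ∈ Γ₀(N)`) holds among the periods of `Φ`: `Σᵢ nᵢ·Φ(γᵢ·∞) = 0`. See the module docstring for the
proof chain (universal Manin chains ⟶ rational cycle ⟶ exactness over `ℚ` ⟶ integral torsion lemma with the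
`S`- and `TS`-fixed cosets killed by `T₂`). [cite: Manin1972, Thm. 1.9] -/
theorem periods_eq_zero_of_periodFunctionals_eq_zero (hN : Odd N)
    (hM : ∀ (γ : Gamma0 N) (r : ℚ), ((γ : SL(2, ℤ)) 1 0 : ℚ) * r + ((γ : SL(2, ℤ)) 1 1 : ℚ) ≠ 0 →
      Φ ((((γ : SL(2, ℤ)) 0 0 : ℚ) * r + ((γ : SL(2, ℤ)) 0 1 : ℚ)) /
        (((γ : SL(2, ℤ)) 1 0 : ℚ) * r + ((γ : SL(2, ℤ)) 1 1 : ℚ))) =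
        (if ((γ : SL(2, ℤ)) 1 0) = 0 then 0 else Φ ((((γ : SL(2, ℤ)) 0 0 : ℚ)) / (((γ : SL(2, ℤ)) 1 0 : ℚ)))) + Φ r)
    (hT : ∀ x : ℚ, (∑ j : Fin 2, Φ ((x + j) / 2)) + Φ (2 * x) = 0)
    (h3 : ∀ r : R, r + r + r = 0 → r = 0)
    (hgenus : twelve_mul_finrank_cuspForm_two (Gamma0 N))
    {ι : Type} [Fintype ι] (n : ι → ℤ) (γ : ι → Gamma0 N)
    (hrel : ∑ i, n i • periodFunctional N (γ i) = 0) :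
    ∑ i, n i • (if (((γ i : Gamma0 N) : SL(2, ℤ)) 1 0) = 0 then 0 else Φ (((((γ i : Gamma0 N) : SL(2, ℤ)) 0 0 : ℚ)) / ((((γ i : Gamma0 N) : SL(2, ℤ)) 1 0 : ℚ)))) = 0 := by
  -- the Manin-symbol system of `Φ` on `SL₂(ℤ)` and its properties (landed files)
  set MS : SL(2, ℤ) → R := fun h ↦ (if (h 1 0) = 0 then 0 else Φ (((h 0 0 : ℚ)) / ((h 1 0 : ℚ)))) - (if ((h * S) 1 0) = 0 then 0 else Φ ((((h * S) 0 0 : ℚ)) / (((h * S) 1 0 : ℚ)))) with hMS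
  have hinv : ∀ (δ : Gamma0 N) (h : SL(2, ℤ)), MS ((δ : SL(2, ℤ)) * h) = MS h := fun δ h ↦ by
    simp only [hMS]; exact maninSymbol_gamma0_mul hM δ h
  have hnegMS : ∀ h, MS (-h) = MS h := fun h ↦ by simp only [hMS]; exact maninSymbol_neg Φ h
  have hSMS : ∀ h, MS (h * S) = -MS h := fun h ↦ by
    have := maninSymbol_two_term Φ h
    simp only [hMS]
    exact eq_neg_of_add_eq_zero_right this
  have hτm : (S * T⁻¹ : SL(2, ℤ)) = ⟨!![0, -1; 1, -1], by norm_num [Matrix.det_fin_two_of]⟩ := by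
    apply Subtype.ext
    rw [coe_mul, coe_S, coe_T_inv]
    ext i j
    fin_cases i <;> fin_cases j <;> simp [Matrix.mul_apply, Fin.sum_univ_two]
  have h3t : ∀ h, MS h + MS (h * (S * T⁻¹)) + MS (h * (S * T⁻¹) * (S * T⁻¹)) = 0 := fun h ↦ by
    have := maninSymbol_three_term Φ h
    simp only [hMS]
    rw [hτm]
    exact this
  have hσ : ∀ (δ : Gamma0 N) (h : SL(2, ℤ)), (δ : SL(2, ℤ)) * h = h * S → MS h = 0 := fun δ h hfix ↦ by
    simp only [hMS]; exact maninSymbol_eq_zero_of_sigmaFixed_of_heckeTwo hN hM hT δ h hfix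
  have hτ0 : ∀ (δ : Gamma0 N) (h : SL(2, ℤ)), (δ : SL(2, ℤ)) * h = h * (S * T⁻¹) → MS h = 0 :=
    fun δ h hfix ↦ apply_eq_zero_of_tau_fixed MS hinv h3t h3 δ h hfix
  -- the system on the coset space `X`
  set M : Gamma0Coset N → R := fun q ↦ MS (q.out)⁻¹ with hMdef
  have hM1 : ∀ q, M (S • q) = -M q := fun q ↦ cosetSystem_S MS hinv hnegMS hSMS q
  have hM2 : ∀ q, M q + M ((T * S) • q) + M ((T * S) • (T * S) • q) = 0 := fun q ↦
    cosetSystem_TS MS hinv hnegMS h3t q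
  have hM3 : ∀ q, S • q = q → M q = 0 := fun q hq ↦ cosetSystem_S_fixed MS hinv hσ q hq
  have hM4 : ∀ q, (T * S) • q = q → M q = 0 := fun q hq ↦ cosetSystem_TS_fixed MS hinv hτ0 q hq
  -- universal chains for the `γ i`
  choose L hL using fun i ↦ exists_maninChain.{0} ((γ i : Gamma0 N) : SL(2, ℤ))
  -- the integral chain `cZ = Σ nᵢ · chainVec (L i)` and its pairing identity
  set cZ : Gamma0Coset N → ℤ := fun q ↦
    ∑ i, n i * ((L i).map fun g ↦ (Pi.single ((g⁻¹ : SL(2, ℤ)) : Gamma0Coset N) (1 : ℤ) : Gamma0Coset N → ℤ)).sum q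
    with hcZ
  have pair : ∀ {V : Type} [AddCommGroup V] (v : Gamma0Coset N → V),
      ∑ q, cZ q • v q = ∑ i, n i • ((L i).map fun g ↦ v ((g⁻¹ : SL(2, ℤ)) : Gamma0Coset N)).sum := by
    intro V _ v
    simp only [hcZ, Finset.sum_smul, mul_smul]
    rw [Finset.sum_comm]
    refine Finset.sum_congr rfl fun i _ ↦ ?_
    rw [← sum_chainVec_smul v (L i), Finset.smul_sum]
  -- the rational chain `c`
  set c : Gamma0Coset N → ℚ := fun q ↦ (cZ q : ℚ) with hc
  have pairQ : ∀ {V : Type} [AddCommGroup V] [Module ℚ V] (v : Gamma0Coset N → V),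
      ∑ q, c q • v q = ∑ i, n i • ((L i).map fun g ↦ v ((g⁻¹ : SL(2, ℤ)) : Gamma0Coset N)).sum := by
    intro V _ _ v
    rw [← pair v]
    exact Finset.sum_congr rfl fun q _ ↦ Int.cast_smul_eq_zsmul ℚ (cZ q) (v q)
  -- `Ψ(c) = Σ nᵢ {∞, γᵢ∞} = 0`
  have hΨ : msymbolMap N c = 0 := by
    have e : msymbolMap N c = ∑ q, c q • msymbol N q := by
      rw [msymbolMap, Fintype.linearCombination_apply]
    rw [e, pairQ (msymbol N)]
    have e3 : ∀ i, ((L i).map fun g ↦ msymbol N ((g⁻¹ : SL(2, ℤ)) : Gamma0Coset N)).sum =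
        periodFunctional N (γ i) := fun i ↦ by
      rw [periodFunctional_eq_inftyFunctional, ← maninChain_sum_msymbolFunctional (hL i)]
      congr 1
      refine List.map_congr_left fun g _ ↦ ?_
      rw [msymbol_mk, inv_inv]
    simp_rw [e3]
    exact hrel
  -- `δ(c) = Σ nᵢ ([γᵢ∞] − [∞]) = 0`
  have hδ : bdryMap N c = 0 := by
    have e : bdryMap N c = ∑ q, c q • bdryVec N q := by
      rw [bdryMap, Fintype.linearCombination_apply]
    rw [e, pairQ (bdryVec N)]
    have e3 : ∀ i, ((L i).map fun g ↦ bdryVec N ((g⁻¹ : SL(2, ℤ)) : Gamma0Coset N)).sum = 0 := fun i ↦ by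
      have hb : ∀ g : SL(2, ℤ), bdryVec N ((g⁻¹ : SL(2, ℤ)) : Gamma0Coset N) =
          Pi.single (cuspOrbitOf N g) (1 : ℚ) - Pi.single (cuspOrbitOf N (g * S)) 1 := fun g ↦ by
        rw [bdryVec, cuspInfty_mk, inv_inv, MulAction.Quotient.smul_mk, smul_eq_mul, cuspInfty_mk, mul_inv_rev,
          inv_inv, inv_inv]
      simp_rw [hb]
      rw [maninChain_sum_cuspOrbitOf (hL i), ← mul_one ((γ i : Gamma0 N) : SL(2, ℤ)),
        cuspOrbitOf_mul_of_mem (γ i).2, sub_self]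
    simp_rw [e3, smul_zero, Finset.sum_const_zero]
  -- exactness over `ℚ`: `c ∈ Rel`
  have hcRel : c ∈ relModule N := by
    rw [← ker_msymbolMap_inf_ker_bdryMap_eq_relModule N hgenus]
    exact ⟨LinearMap.mem_ker.mpr hΨ, LinearMap.mem_ker.mpr hδ⟩
  obtain ⟨y, hy, z, hz, hyz⟩ := Submodule.mem_sup.mp hcRel
  obtain ⟨u, rfl⟩ := LinearMap.mem_range.mp hy
  obtain ⟨v, rfl⟩ := LinearMap.mem_range.mp hz
  -- clear denominators
  set D : ℕ := ∏ q, ((u q).den * (v q).den) with hD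
  have hD0 : D ≠ 0 := Finset.prod_ne_zero_iff.mpr fun q _ ↦ mul_ne_zero (u q).den_nz (v q).den_nz
  have hdu : ∀ q, (u q).den ∣ D := fun q ↦
    (Dvd.intro _ rfl : (u q).den ∣ (u q).den * (v q).den).trans (Finset.dvd_prod_of_mem _ (Finset.mem_univ q))
  have hdv : ∀ q, (v q).den ∣ D := fun q ↦
    (Dvd.intro_left _ rfl : (v q).den ∣ (u q).den * (v q).den).trans (Finset.dvd_prod_of_mem _ (Finset.mem_univ q))
  choose uZ huZ using fun q ↦ exists_int_cast_eq_natCast_mul (u q) D (hdu q)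
  choose vZ hvZ using fun q ↦ exists_int_cast_eq_natCast_mul (v q) D (hdv q)
  have hSS : ∀ q : Gamma0Coset N, S • S • q = q := fun q ↦ by
    rw [← mul_smul, S_mul_S_eq_neg_one, neg_one_smul_coset]
  have hTS3 : ∀ q : Gamma0Coset N, (T * S) • (T * S) • (T * S) • q = q := fun q ↦ by
    rw [← mul_smul, ← mul_smul, TS_pow_three_eq, neg_one_smul_coset]
  set AZ : Gamma0Coset N → ℤ := fun q ↦ uZ q + uZ (S • q) with hAZ'
  set BZ : Gamma0Coset N → ℤ := fun q ↦ vZ q + vZ ((T * S) • q) + vZ ((T * S) • (T * S) • q) with hBZ'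
  have hAZ : ∀ q, AZ (S • q) = AZ q := fun q ↦ by
    show uZ (S • q) + uZ (S • S • q) = uZ q + uZ (S • q)
    rw [hSS, add_comm]
  have hBZ : ∀ q, BZ ((T * S) • q) = BZ q := fun q ↦ by
    show vZ ((T * S) • q) + vZ ((T * S) • (T * S) • q) + vZ ((T * S) • (T * S) • (T * S) • q) =
      vZ q + vZ ((T * S) • q) + vZ ((T * S) • (T * S) • q)
    rw [hTS3]; abel
  have hrelZ : ∀ q, (D : ℤ) * cZ q = AZ q + BZ q + 0 := fun q ↦ by
    have e := congrFun hyz q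
    have e' : c q = (u q + u (S • q)) + (v q + v ((T * S) • q) + v ((T * S) • (T * S) • q)) := by
      rw [← e]
      simp only [relTwo, relThree, Pi.add_apply, LinearMap.add_apply, LinearMap.id_apply, LinearMap.comp_apply,
        cosetPerm_apply]
    apply Int.cast_injective (α := ℚ)
    rw [add_zero]
    push_cast
    rw [show ((cZ q : ℤ) : ℚ) = c q from rfl, e', show ((AZ q : ℤ) : ℚ) = (uZ q : ℚ) + (uZ (S • q) : ℚ) by
      simp only [hAZ']; push_cast; rfl, show ((BZ q : ℤ) : ℚ) = (vZ q : ℚ) + (vZ ((T * S) • q) : ℚ) +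
      (vZ ((T * S) • (T * S) • q) : ℚ) by simp only [hBZ']; push_cast; rfl, huZ, huZ, hvZ, hvZ, hvZ]
    ring
  -- the torsion lemma
  have key := sum_smul_eq_zero_of_mul_eq_relation (X := Gamma0Coset N) (fun q ↦ S • q) (fun q ↦ (T * S) • q)
    hSS hTS3 M hM1 hM2 hM3 hM4 h3 cZ AZ BZ (fun _ ↦ 0) (D : ℤ) (by exact_mod_cast hD0) hAZ hBZ
    (fun q h ↦ (h rfl).elim) hrelZ
  rw [pair M] at key
  have e4 : ∀ i, ((L i).map fun g ↦ M ((g⁻¹ : SL(2, ℤ)) : Gamma0Coset N)).sum =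
      (if (((γ i : Gamma0 N) : SL(2, ℤ)) 1 0) = 0 then 0 else Φ (((((γ i : Gamma0 N) : SL(2, ℤ)) 0 0 : ℚ)) / ((((γ i : Gamma0 N) : SL(2, ℤ)) 1 0 : ℚ)))) := fun i ↦ by
    rw [← maninChain_sum_maninSymbol Φ (hL i)]
    congr 1
    refine List.map_congr_left fun g _ ↦ ?_
    show MS ((((g⁻¹ : SL(2, ℤ)) : Gamma0Coset N)).out)⁻¹ = _
    rw [apply_out_inv_mk MS hinv, inv_inv]
  simp_rw [e4] at key
  exact key

end Assembly

end Summit.BirchSwinnertonDyer.BirchSwinnertonDyer.Theorems.ThetaLayerLambdaCongruenceAtTwo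

end
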